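import Summits.MatrixMultiplication.OmegaCensus.Z4Z4DominoUniformKit
import HarnessLib

/-!
# Per-point congruences for the uniform domino theorem over `A ↠ ℤ₄ × ℤ₄`

ω-census `pub-omega`, family (b3), seat pub-omega-group gen 16.  Framing: lottery ticket; floor = certified bounds/negative
ranges.  VALUE: bookkeeping lemmas behind `no_shifted_form_of_onto_z4z4` (`DominoUniformZ4Z4.lean`); NOT progress on ω.

For a point with exponents `(m, n)` in the coordinates `w, w'` the values of the characters `w`, `w + 2w'`, `w'`, `w' + 2w` are
`i^m`, `i^(m+2n)`, `i^n`, `i^(n+2m)`, and the real characters `2w, 2w', 2(w+w')` take the values `i^(2m), i^(2n), i^(2(m+n))`.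
The lemmas below (all `decide`) express the real and imaginary parts of `i^m ± i^(m+2n)` etc. modulo `4`, and the real
characters exactly, through the indicator of the parity class `(m mod 2, n mod 2)` of the point; `gi_re_sum / gi_im_sum` push
`re / im` through finite sums.  Summed over `X`, they give the linear congruences fed to `omega` in the uniform theorem.
-/

namespace Summit.MatrixMultiplication.OmegaCensus

open Finset

/-! ## `re` and `im` of finite sums -/

/-- `re` of a finite sum of Gaussian integers. [folklore] -/
theorem gi_re_sum {α : Type*} (s : Finset α) (f : α → GaussianInt) : (∑ x ∈ s, f x).re = ∑ x ∈ s, (f x).re :=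
  map_sum (AddMonoidHom.mk' (fun z : GaussianInt => z.re) (fun z w => by simp)) f s

/-- `im` of a finite sum of Gaussian integers. [folklore] -/
theorem gi_im_sum {α : Type*} (s : Finset α) (f : α → GaussianInt) : (∑ x ∈ s, f x).im = ∑ x ∈ s, (f x).im :=
  map_sum (AddMonoidHom.mk' (fun z : GaussianInt => z.im) (fun z w => by simp)) f s

/-! ## The pair `w, w + 2w'` (exponents `m`, `m + 2n`) -/

/-- `Re(i^m + i^(m+2n)) ≡ 2·[m, n even] (mod 4)`. [folklore] -/
theorem reim_L1 (m n : ZMod 4) :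
    ((((⟨0, 1⟩ : GaussianInt) ^ m.val + (⟨0, 1⟩ : GaussianInt) ^ (m + 2 * n).val).re : ℤ) : ZMod 4) =
      if 2 * m = 0 ∧ 2 * n = 0 then 2 else 0 := by
  revert m n; decide

/-- `Im(i^m + i^(m+2n)) ≡ 2·[m odd, n even] (mod 4)`. [folklore] -/
theorem reim_L2 (m n : ZMod 4) :
    ((((⟨0, 1⟩ : GaussianInt) ^ m.val + (⟨0, 1⟩ : GaussianInt) ^ (m + 2 * n).val).im : ℤ) : ZMod 4) =
      if 2 * m = 2 ∧ 2 * n = 0 then 2 else 0 := by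
  revert m n; decide

/-- `Re(i^m − i^(m+2n)) ≡ 2·[m even, n odd] (mod 4)`. [folklore] -/
theorem reim_L3 (m n : ZMod 4) :
    ((((⟨0, 1⟩ : GaussianInt) ^ m.val - (⟨0, 1⟩ : GaussianInt) ^ (m + 2 * n).val).re : ℤ) : ZMod 4) =
      if 2 * m = 0 ∧ 2 * n = 2 then 2 else 0 := by
  revert m n; decide

/-- `Im(i^m − i^(m+2n)) ≡ 2·[m odd, n odd] (mod 4)`. [folklore] -/
theorem reim_L4 (m n : ZMod 4) :
    ((((⟨0, 1⟩ : GaussianInt) ^ m.val - (⟨0, 1⟩ : GaussianInt) ^ (m + 2 * n).val).im : ℤ) : ZMod 4) =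
      if 2 * m = 2 ∧ 2 * n = 2 then 2 else 0 := by
  revert m n; decide

/-! ## The pair `w', w' + 2w` (exponents `n`, `n + 2m`) -/

/-- `Re(i^n + i^(n+2m)) ≡ 2·[m, n even] (mod 4)`. [folklore] -/
theorem reim_L5 (m n : ZMod 4) :
    ((((⟨0, 1⟩ : GaussianInt) ^ n.val + (⟨0, 1⟩ : GaussianInt) ^ (n + 2 * m).val).re : ℤ) : ZMod 4) =
      if 2 * m = 0 ∧ 2 * n = 0 then 2 else 0 := by
  revert m n; decide

/-- `Im(i^n + i^(n+2m)) ≡ 2·[m even, n odd] (mod 4)`. [folklore] -/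
theorem reim_L6 (m n : ZMod 4) :
    ((((⟨0, 1⟩ : GaussianInt) ^ n.val + (⟨0, 1⟩ : GaussianInt) ^ (n + 2 * m).val).im : ℤ) : ZMod 4) =
      if 2 * m = 0 ∧ 2 * n = 2 then 2 else 0 := by
  revert m n; decide

/-- `Re(i^n − i^(n+2m)) ≡ 2·[m odd, n even] (mod 4)`. [folklore] -/
theorem reim_L7 (m n : ZMod 4) :
    ((((⟨0, 1⟩ : GaussianInt) ^ n.val - (⟨0, 1⟩ : GaussianInt) ^ (n + 2 * m).val).re : ℤ) : ZMod 4) =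
      if 2 * m = 2 ∧ 2 * n = 0 then 2 else 0 := by
  revert m n; decide

/-- `Im(i^n − i^(n+2m)) ≡ 2·[m odd, n odd] (mod 4)`. [folklore] -/
theorem reim_L8 (m n : ZMod 4) :
    ((((⟨0, 1⟩ : GaussianInt) ^ n.val - (⟨0, 1⟩ : GaussianInt) ^ (n + 2 * m).val).im : ℤ) : ZMod 4) =
      if 2 * m = 2 ∧ 2 * n = 2 then 2 else 0 := by
  revert m n; decide

/-! ## The real characters `2w, 2w', 2(w+w')` -/

/-- `i^(2s)` is real. [folklore] -/
theorem ipow_two_mul_im (s : ZMod 4) : ((⟨0, 1⟩ : GaussianInt) ^ (2 * s).val).im = 0 := by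
  revert s; decide

/-- `Re i^(2m) = [ee] + [eo] − [oe] − [oo]` (classes by the parities of `m, n`). [folklore] -/
theorem re_R1 (m n : ZMod 4) : (((⟨0, 1⟩ : GaussianInt) ^ (2 * m).val).re : ℤ) =
    (if 2 * m = 0 ∧ 2 * n = 0 then 1 else 0) + (if 2 * m = 0 ∧ 2 * n = 2 then 1 else 0) -
      (if 2 * m = 2 ∧ 2 * n = 0 then 1 else 0) - (if 2 * m = 2 ∧ 2 * n = 2 then 1 else 0) := by
  revert m n; decide

/-- `Re i^(2n) = [ee] − [eo] + [oe] − [oo]`. [folklore] -/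
theorem re_R2 (m n : ZMod 4) : (((⟨0, 1⟩ : GaussianInt) ^ (2 * n).val).re : ℤ) =
    (if 2 * m = 0 ∧ 2 * n = 0 then 1 else 0) - (if 2 * m = 0 ∧ 2 * n = 2 then 1 else 0) +
      (if 2 * m = 2 ∧ 2 * n = 0 then 1 else 0) - (if 2 * m = 2 ∧ 2 * n = 2 then 1 else 0) := by
  revert m n; decide

/-- `Re i^(2(m+n)) = [ee] − [eo] − [oe] + [oo]`. [folklore] -/
theorem re_R3 (m n : ZMod 4) : (((⟨0, 1⟩ : GaussianInt) ^ (2 * (m + n)).val).re : ℤ) =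
    (if 2 * m = 0 ∧ 2 * n = 0 then 1 else 0) - (if 2 * m = 0 ∧ 2 * n = 2 then 1 else 0) -
      (if 2 * m = 2 ∧ 2 * n = 0 then 1 else 0) + (if 2 * m = 2 ∧ 2 * n = 2 then 1 else 0) := by
  revert m n; decide

end Summit.MatrixMultiplication.OmegaCensus
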